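import Literature.Probability.LatticeModels.LroInfraredBound
import Literature.Probability.LatticeModels.GaussianDominationProofs
import Literature.Probability.LatticeModels.GKSInequalities
import Literature.Probability.LatticeModels.CriticalTwoPointLower
import Literature.Probability.LatticeModels.TorusZeroMode
import HarnessLib

/-!
# Discharges of ADS15 (3.18), (3.17), (3.13) and of Griffiths' box/torus comparison

(Sibling proof file of `LroInfraredBound.lean`.)

Topic `Probability/LatticeModels`, namespace `Literature.Probability.LatticeModels`. Sibling proof
file of `LroInfraredBound.lean`; theorem-only (no definitions, no named facts). It **discharges** the
named fact `Literature.Probability.LatticeModels.ads_freePair_leftContinuous` of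
`LroInfraredBound.lean`:

* M. Aizenman, H. Duminil-Copin, V. Sidoravicius, *Random currents and continuity of Ising
  model's spontaneous magnetization*, Comm. Math. Phys. **334** (2015) 719–742, §3.3, the display
  preceding (3.19) (eq. (3.18) of arXiv:1311.1937v3, the version held in the literature store):
  "by the Griffith inequality [Gri67], the `⟨σ_xσ_y⟩⁰_{Λ_L,β}` are monotone increasing functions
  of `β` and also monotone increasing in `L`. Standard semicontinuity arguments which are
  applicable under such monotonicity assumptions allow to conclude that for each `x, y ∈ ℤ^d`,
  `⟨σ_xσ_y⟩⁰_{β_c} = lim_{β ↗ β_c} lim_{L → ∞} ⟨σ_xσ_y⟩⁰_{Λ_L,β}`" (see also the proof of their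
  Prop. 5.1: `⟨σ_A⟩⁰_β = lim_{ε ↘ 0} ⟨σ_A⟩⁰_{β-ε}`).

The mathematical content is already in the tree: `LroInfraredBound.lean` proves the fact from
GKS II, the existence of the free state and `β_c > 0` (`ads_freePair_leftContinuous_of_gks`, via
`freePair_leftContinuous_of_gks` of `GriffithsMonotonicity.lean`: a monotone limit of continuous
nondecreasing functions is lower semicontinuous, hence left-continuous). The three inputs are
discharged elsewhere in the tree — GKS II (`GKSInequalities.gks_two_holds`, Friedli–Velenik 2017,
Thm. 3.49/3.20), the free-state box limit (`hasBoxLimit_isingCorr_free_holds`, Friedli–Velenik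
2017, Exercise 3.16) and `β_c > 0` for `d ≥ 2` (`criticalBeta_pos_holds`, from Peierls' estimate,
`CriticalTwoPointLower.lean`) — and this file only assembles them. It is a separate file because
`criticalBeta_pos_holds` lives above `LroInfraredBound.lean` in the import graph
(`CriticalTwoPointLower` → … → `TorusZeroMode` → `LroInfraredBound`), so the discharge cannot be
appended to the fact's own file without an import cycle.

## Also discharged here: ADS15 (3.17), the torus zero mode below `β_c`

`ads_torusZeroMode_tendsto_holds` closes the named fact
`Literature.Probability.LatticeModels.ads_torusZeroMode_tendsto` of `LroInfraredBound.lean` —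
Aizenman–Duminil-Copin–Sidoravicius, CMP 334 (2015), **§3.3, eq. (3.17) of arXiv:1311.1937v3,
p. 25**: for `β < β_c`,
`0 ≤ lim_L L^{-d} F̂_{L,β}(0) = lim_L |𝕋_L|⁻¹ ∑_{x ∈ 𝕋_L} ⟨σ_0σ_x⟩_{𝕋_L,β}
   ≤ lim_L |Λ_L|⁻¹ ∑_{x ∈ Λ_L} ⟨σ_0σ_x⟩⁺_{Λ_L,β} = 0`,
"where use is made of the fact that `∑_{x ∈ ℤ^d} ⟨σ_0σ_x⟩⁺_β < ∞` for any `β < β_c` ([ABF87])",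
vendored in `ε`–`L₀` form (`2 ≤ d`, `0 < β < β_c`). Again the content is already in the tree:
`ads_torusZeroMode_tendsto_of_gks` (`TorusZeroMode.lean`) derives the fact from GKS II for the
finite-volume models on the torus graphs, GKS I on `ℤ^d` and the existence of the plus state, via
the two-box bound `L^{-d} ∑_x ⟨σ_0σ_x⟩_{𝕋_L;β} ≤ (4R+3)^d L^{-d} + (⟨σ_0⟩⁺_{Λ_R;β})²`
(Friedli–Velenik 2017, Exercise 3.15, run on the torus) and `⟨σ_0⟩⁺_{Λ_R;β} → m*(β) = 0` for
`0 ≤ β < β_c` — i.e. directly from the definition of `β_c` as the onset of spontaneous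
magnetisation (`criticalBeta`; this is also ADS15's `β_c`, §1.1: "`m*(β) > 0` for `β > β_c`"), in
place of ADS15's appeal to the finiteness of the susceptibility (Aizenman–Barsky–Fernández 1987).
The three inputs are the discharged tree facts `GKSInequalities.gks_two_holds`,
`GKSInequalities.gks_one_holds` and `hasBoxLimit_isingCorr_plus_holds` (`GKSInequalities.lean`);
`TorusZeroMode.lean` imports `LroInfraredBound.lean`, so this discharge, too, cannot live in the
fact's own file.

## Also discharged here: ADS15 (3.13), Gaussian domination in `x`-space on the torus

`ads_gaussianDomination_holds` closes the named fact
`Literature.Probability.LatticeModels.ads_gaussianDomination` of `LroInfraredBound.lean` —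
M. Aizenman, H. Duminil-Copin, V. Sidoravicius, CMP 334 (2015), **§3.3, eq. (3.13) of
arXiv:1311.1937v3** ("The Gaussian domination bound (1.19) (also known as the infrared bound) can
be equivalently formulated as the statement that for any function `(v_x)`, …
`∑_{x,y} v_x v_y F_{L,β}(x,y) ≤ (2β)⁻¹ ∑_{x,y} v_x v_y G_L(x,y) + L^{-d} F̂_{L,β}(0) |∑_x v_x|²`"),
for the nearest-neighbour Ising model on `(ℤ/Lℤ)^d`, `L` even, `L ≠ 2`, `β > 0`, real `v`, with
the tree's constant (`torusGreen = 2 G_L`, see the docstring of the fact). The proof is exactly the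
printed one-line argument: (3.13) is the `x`-space form of the momentum-space infrared bound,
ADS15 Prop. 1.3 (= Fröhlich–Simon–Spencer, Comm. Math. Phys. **50** (1976), Thm. 3.1;
Friedli–Velenik 2017, Thm. 10.24), and both halves are already theorems of the tree:

* the Fourier-inversion step "(3.13) ⇔ Prop. 1.3" is `ads_gaussianDomination_of_infraredBound`
  (`LroInfraredBound.lean`: character expansion of the two quadratic forms on `(ℤ/Lℤ)^d`, the
  `k = 0` term is the zero mode, the `k ≠ 0` terms are compared by the infrared bound);
* the infrared bound itself, the tree's named fact `infraredBound`, is `infraredBound_holds`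
  (`GaussianDominationProofs.lean`: reflection positivity through bond-bisecting planes and the
  descent on bad bonds, Friedli–Velenik 2017, Prop. 10.27 ⇒ Thm. 10.24).

Neither of `LroInfraredBound.lean`, `GaussianDominationProofs.lean` imports the other, so this
discharge joins the two import branches here. Consequence recorded for users of
`LroInfraredBound.lean`: the block form `torus_blockSum_le` holds unconditionally
(`torus_blockSum_le_holds`). `#print axioms ads_gaussianDomination_holds`: `propext`,
`Classical.choice`, `Quot.sound`.

## Also discharged here: Griffiths' comparison of the free box with the torus

`isingTwoPoint_free_box_le_torus_holds` closes the fourth and last named fact of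
`LroInfraredBound.lean`, `Literature.Probability.LatticeModels.isingTwoPoint_free_box_le_torus` —
the form of Griffiths' second inequality used by Aizenman–Duminil-Copin–Sidoravicius, CMP 334
(2015), §3.3, proof of (3.19) ("by the Griffith inequality [Gri67],
`⟨σ_xσ_y⟩⁰_{Λ_L,β} ≤ ⟨σ_xσ_y⟩_{𝕋_L,β}`"), vendored after S. Friedli, Y. Velenik, *Statistical
Mechanics of Lattice Systems* (CUP 2017), §3.8.1, **Exercise 3.31, p. 142** ("Let `K = (K_C)`
and `K' = (K'_C)` be such that `K_C ≥ |K'_C|` … Show that, for any `A ⊂ Λ`,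
`⟨σ_A⟩_{Λ;K} ≥ ⟨σ_A⟩_{Λ;K'}`") **with Exercise 3.30, p. 141** (the free and periodic Gibbs
distributions are of the form `ν_{Λ;K}` with nonnegative coupling constants when `h ≥ 0`): for
`β ≥ 0`, zero field, `2n + 1 < L` and `x, y ∈ Λ_n = [-n,n]^d`,
`⟨σ_xσ_y⟩^∅_{Λ_n;β} ≤ ⟨σ_{x̄}σ_{ȳ}⟩_{𝕋_L;β}` (`x̄ = x mod L`), the torus couplings (`β` on every
bond of `(ℤ/Lℤ)^d`) dominating those of the embedded free box (`β` on the bonds inside the image of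
`Λ_n`, an induced subgraph since `2n + 1 < L`, and `0` elsewhere). Once more the content is already
in the tree: `isingTwoPoint_free_box_le_torus_of_gks'` (`LroInfraredBound.lean`) derives the fact
from GKS II for the finite-volume models on the torus graphs (transport of the free box to its
isomorphic image, `IsingTransport.lean`, then volume monotonicity of the free boundary condition
inside the torus, `isingCorr_free_mono_volume_of_gks`, which is the coupling monotonicity of
Exercise 3.31 for the added nonnegative bonds), and GKS II is the discharged tree fact
`GKSInequalities.gks_two_holds` (Friedli–Velenik 2017, Thm. 3.49/3.20), valid on every locally
finite graph; neither GKS proof file is imported by `LroInfraredBound.lean`, so the three-line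
assembly lives here next to the other discharges. `#print axioms
isingTwoPoint_free_box_le_torus_holds`: `propext`, `Classical.choice`, `Quot.sound`.

## Mathlib status

No Ising model in Mathlib; nothing here is Mathlib material.
-/

namespace Literature.Probability.LatticeModels

variable {d : ℕ}

/-- **Discharge of `ads_freePair_leftContinuous` (ADS15 §3.3, arXiv v3 eq. (3.18)).** For the
nearest-neighbour Ising model on `ℤ^d`, `d ≥ 2`, and all `x, y ∈ ℤ^d`, the free-state pair
correlation `β ↦ ⟨σ_xσ_y⟩^∅_β` (`freePair d β x y`) is left-continuous at `β_c`:
`⟨σ_xσ_y⟩^∅_{β_c} = lim_{β ↗ β_c} ⟨σ_xσ_y⟩^∅_β` (Aizenman–Duminil-Copin–Sidoravicius, CMP 334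
(2015), §3.3: "by the Griffith inequality … monotone increasing functions of `β` and also monotone
increasing in `L`. Standard semicontinuity arguments … allow to conclude that
`⟨σ_xσ_y⟩⁰_{β_c} = lim_{β ↗ β_c} lim_{L → ∞} ⟨σ_xσ_y⟩⁰_{Λ_L,β}`"). Proof: the conditional theorem
`ads_freePair_leftContinuous_of_gks` fed with the discharged GKS II (`GKSInequalities.gks_two_holds`),
the discharged existence of the free state (`hasBoxLimit_isingCorr_free_holds`) and the discharged
`β_c > 0` (`criticalBeta_pos_holds`). [cite: AizenmanDuminilCopinSidoraviciusCMP2015, §3.3, arXiv v3 eq. (3.18)] -/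
theorem ads_freePair_leftContinuous_holds : ads_freePair_leftContinuous (d := d) :=
  ads_freePair_leftContinuous_of_gks
    (fun G' _ _ _ _ _ _ _ => GKSInequalities.gks_two_holds G')
    hasBoxLimit_isingCorr_free_holds criticalBeta_pos_holds

/-- **ADS15 eq. (3.17), discharged** (Aizenman–Duminil-Copin–Sidoravicius, CMP 334 (2015), §3.3,
eq. (3.17) of arXiv:1311.1937v3, p. 25): for the nearest-neighbour Ising model on `ℤ^d`, `d ≥ 2`,
and `0 < β < β_c`, the torus zero mode `L^{-d} F̂_{L,β}(0) = L^{-d} ∑_{x ∈ 𝕋_L} ⟨σ_0σ_x⟩_{𝕋_L,β}`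
(`torusZeroMode d L β`) is eventually `≤ ε` for every `ε > 0`
("`0 ≤ lim_L L^{-d} F̂_{L,β}(0) ≤ lim_L |Λ_L|⁻¹ ∑_{x ∈ Λ_L} ⟨σ_0σ_x⟩⁺_{Λ_L,β} = 0`"). Proof: the
conditional theorem `ads_torusZeroMode_tendsto_of_gks` (`TorusZeroMode.lean`: GKS II comparison of
the torus two-point function with two edge-separated `+` boxes, and `m*(β) = 0` below `β_c`) fed
with the discharged classical facts `GKSInequalities.gks_two_holds` (on the torus graphs
`(ℤ/Lℤ)^d`), `GKSInequalities.gks_one_holds` (on `ℤ^d`) and `hasBoxLimit_isingCorr_plus_holds`. [cite: AizenmanDuminilCopinSidoraviciusCMP2015, §3.3, eq. (3.17)] -/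
theorem ads_torusZeroMode_tendsto_holds : ads_torusZeroMode_tendsto (d := d) :=
  ads_torusZeroMode_tendsto_of_gks
    (fun L _ _ _ _ _ _ _ => GKSInequalities.gks_two_holds (torusGraph d L))
    (fun _ _ _ _ _ => GKSInequalities.gks_one_holds (zdGraph d))
    hasBoxLimit_isingCorr_plus_holds

section GaussianDomination

open Finset Literature.Probability.Percolation

/-- **ADS15 eq. (3.13), proved** (Aizenman–Duminil-Copin–Sidoravicius, CMP 334 (2015), §3.3,
eq. (3.13) of arXiv:1311.1937v3; the `x`-space form of the Gaussian domination / infrared bound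
Prop. 1.3 = Fröhlich–Simon–Spencer 1976, Thm. 3.1): the named fact `ads_gaussianDomination`
holds — for the nearest-neighbour Ising model on the torus `(ℤ/Lℤ)^d`, `L` even, `L ≠ 2`,
`β > 0`, and every real `v`,
`∑_{x,y} v_x v_y ⟨σ_xσ_y⟩_{𝕋_L,β} ≤ (2β)⁻¹ ∑_{x,y} v_x v_y G̃_L(x - y) + L^{-d} F̂_{L,β}(0) (∑_x v_x)²`
(`G̃_L = torusGreen`). From the infrared bound `infraredBound_holds` (reflection positivity,
`GaussianDominationProofs.lean`) by the Fourier step `ads_gaussianDomination_of_infraredBound`. [cite: AizenmanDuminilCopinSidoraviciusCMP2015, §3.3, eq. (3.13)] -/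
theorem ads_gaussianDomination_holds : ads_gaussianDomination (d := d) :=
  ads_gaussianDomination_of_infraredBound fun _ _ => infraredBound_holds

/-- **ADS15 (3.13) for a block, unconditionally**: for `L` even, `L ≠ 2`, `β > 0` and every finite
`B ⊂ ℤ^d`,
`∑_{x,y ∈ B} ⟨σ_{x̄}σ_{ȳ}⟩_{𝕋_L,β} ≤ (2β)⁻¹ ∑_{x,y ∈ B} G̃_L(x̄ - ȳ) + L^{-d} F̂_{L,β}(0) |B|²`
(`x̄ = x mod L`) — `torus_blockSum_le` of `LroInfraredBound.lean` fed with
`ads_gaussianDomination_holds` (Aizenman–Duminil-Copin–Sidoravicius, CMP 334 (2015), §3.3, (3.13)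
with `v = 1_{Λ_n}`, as used for (3.19)). [cite: AizenmanDuminilCopinSidoraviciusCMP2015, §3.3, eqs. (3.13) and (3.19)] -/
theorem torus_blockSum_le_holds (L : ℕ) [NeZero L] (hL : Even L) (hL2 : L ≠ 2) {β : ℝ}
    (hβ : 0 < β) (B : Finset (Site d)) :
    ∑ x ∈ B, ∑ y ∈ B, isingTorusTwoPoint d L β 0 (Torus.proj L x) (Torus.proj L y) ≤
      (∑ x ∈ B, ∑ y ∈ B, torusGreen (Torus.proj L x - Torus.proj L y)) / (2 * β) +
        torusZeroMode d L β * (#B : ℝ) ^ 2 :=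
  torus_blockSum_le ads_gaussianDomination_holds L hL hL2 hβ B

end GaussianDomination

/-! ### Griffiths' comparison of the free box with the torus -/

/-- **Discharge of `isingTwoPoint_free_box_le_torus` (Griffiths' second inequality, free box
versus torus).** For the nearest-neighbour Ising model at `β ≥ 0` and zero field: if
`2n + 1 < L`, so that the box `Λ_n = [-n,n]^d` projects injectively onto an induced subgraph of the
torus `(ℤ/Lℤ)^d`, then for all `x, y ∈ Λ_n`,
`⟨σ_xσ_y⟩^∅_{Λ_n;β,0} ≤ ⟨σ_{x̄}σ_{ȳ}⟩_{𝕋_L;β,0}` with `x̄ = Torus.proj L x`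
(Friedli–Velenik 2017, Exercise 3.31, p. 142: `K_C ≥ |K'_C|` for all `C` implies
`⟨σ_A⟩_{Λ;K} ≥ ⟨σ_A⟩_{Λ;K'}`, applied on the torus with `K =` the torus couplings and `K' =` the
couplings of the embedded free box, which are of this form with nonnegative constants by
Exercise 3.30, p. 141; this is the inequality "`⟨σ_xσ_y⟩⁰_{Λ_L,β} ≤ ⟨σ_xσ_y⟩_{𝕋_L,β}` by the
Griffith inequality" of Aizenman–Duminil-Copin–Sidoravicius, CMP 334 (2015), §3.3, proof of
(3.19)). Proof: the conditional theorem `isingTwoPoint_free_box_le_torus_of_gks'`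
(`LroInfraredBound.lean`: transport along the embedding, then volume monotonicity of the free
boundary condition from GKS II) fed with the discharged GKS II inequality
`GKSInequalities.gks_two_holds` for the finite-volume models on subgraphs of the torus graphs
`(ℤ/Lℤ)^d`. [cite: FriedliVelenik2017, Exercise 3.31, p. 142, with Exercise 3.30, p. 141] -/
theorem isingTwoPoint_free_box_le_torus_holds : isingTwoPoint_free_box_le_torus (d := d) :=
  isingTwoPoint_free_box_le_torus_of_gks'
    (fun _ _ G' _ _ _ _ _ _ _ => GKSInequalities.gks_two_holds G')

end Literature.Probability.LatticeModels
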